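import Literature.MathematicalPhysics.QuantumFieldTheory.Balaban1983to89.B1LowerBound
import Literature.MathematicalPhysics.QuantumFieldTheory.Balaban1983to89.B2Sect2Statements

/-!
# `Balaban1983to89.B2Thm13Bridge` — T. Bałaban, *(Higgs)₂,₃ quantum fields in a finite volume. II. An upper bound*,
# Commun. Math. Phys. **86** (1982) 555–594 [Balaban1982Higgs2], Theorem (1.3) p. 556 ≡ part I [Balaban1982Higgs1]
# Theorem (1.14) p. 606: the two typed carriers of the ONE printed theorem are EQUIVALENT (knitting bridge, KERNEL)

statement-level skeleton of published theorems with citation tags; proofs where landed; nothing here is a claim about the Yang–Mills mass gap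

PDF held: `paper:balaban1982-cmp86-higgs23-ii` (journal page = PDF page + 554), p. 556 [PDF 2]; `paper:balaban1982-cmp85-higgs23-i`
(journal page = PDF page + 602), p. 606 [PDF 4], p. 607 (1.21).

WHAT IS REPRODUCED.  SKELETON rows **B2.Thm@556** (decl of record `B2Sect2Statements.MainThmPrinted`, v1.3 p243199, carrier
`B2Sect2Statements.PartitionData` = (#T_ε, Z^ε) per instance plus the family of spacings `eps : I → ℝ`, volume `volEps` =
ε^d·#T_ε, guard `P.Printed` of `B2.Params`) and **B1.Thm@606** (decl of record `B1LowerBound.ThmPrinted`, p239114, carrier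
`B1LowerBound.CutoffFamily` = (ε, |T_ε|, Z^ε) per instance, |T_ε| an abstract real) of `run/shared/lean/pub/lit-balaban/SKELETON.md`:
p. 556 [PDF 2], verbatim, *"**Theorem.** For the dimensions d = 2, 3 there exist the constants E₋, E₊ independent of ε, T_ε and
such that exp(−E₋|T_ε|) ≤ Z^ε ≤ exp(E₊|T_ε|). (1.3)  In the first part [1], we have proved the first inequality above, the
lower bound. Now we will prove the upper bound."* — the same sentence as part I p. 606 (1.14).  Phase-2 RESERVE item **R12** of
`PHASE2-TARGETS.md` §G.3 (the r14/r01 knitting nomination «bridge D10», `lit-balaban-r14/ROWS-B2.md` §DUPLICATES D10: *"one decl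
per paper row; carriers differ; cross-referenced"*), unblocked by the lead's ruling G.5-2 once the printed-volume repair
`PartitionData.volEps`/`MainThmPrinted` landed (p243199).  Cell `lit-balaban`, seat p39 (gen 2, unit `lit-balaban-p39`), HOME
`run/shared/lean/pub/lit-balaban/`.

WHAT THIS MODULE PROVES (kernel; theorem-only, no new definition, no new `Prop`).  For a B1 cutoff family `F` and B2 data
`fam` over the same index type that CARRY THE SAME NUMBERS — `F.vol i = ε_i^d·#T_{ε_i}` (`PartitionData.volEps`) and `F.Z i = Z^{ε_i}`
(hypotheses `hvol`, `hZ`; the dictionary) —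
* `lowerBoundPrinted_iff`, `upperBoundPrinted_iff`, `mainThmPrinted_iff` : B2's `LowerBoundPrinted`/`UpperBoundPrinted`/
  `MainThmPrinted P F.eps fam` ↔ (`P.Printed` → B1's `LowerBoundPrinted`/`UpperBoundPrinted`/`ThmPrinted F`) — B2 guards the
  statement by the printed parameter clause *"For the dimensions d = 2, 3"* (`B2.Params.Printed`), B1's carrier fixes the model
  outside the statement, so the bridge is an equivalence UNDER that clause and an implication B1 ⇒ B2 without it
  (`mainThmPrinted_of_thmPrinted`, `thmPrinted_of_mainThmPrinted`);
* the two canonical instances of the dictionary: `mainThmPrinted_iff_thmPrinted_volEps` (read a B2 family AS a B1 cutoff family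
  with `vol := volEps`) and `thmPrinted_iff_mainThmPrinted_of_count` (a B1 cutoff family whose volumes are ε^d times site counts
  `n i` IS a B2 family `⟨n i, Z i⟩`), and the halves likewise.
Nothing of either paper is asserted: both sides stay hypotheses/statements; the value is that a proof of either typed form
of (1.3)/(1.14) transports to the other by these theorems (ref-2 I2 «twins» closed by a bridge, not by pruning).
-/

namespace Literature.MathematicalPhysics.QuantumFieldTheory.Balaban1983to89.B2Thm13Bridge

open B1LowerBound (CutoffFamily LowerBoundWith UpperBoundWith ThmPrinted)
open B2Sect2Statements (PartitionData MainThmPrinted)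

variable {I : Type}

/-! ## §1 The dictionary hypotheses and the three equivalences -/

/-- **Lower bound, B2 form ↔ B1 form.**  p. 556: *"In the first part [1], we have proved the first inequality above, the
lower bound"* — B2's `LowerBoundPrinted P F.eps fam` (∃E₋ ∀(ε,T_ε), exp(−E₋ε^d#T_ε) ≤ Z^ε, under `P.Printed`) is, for data
carrying the same volumes and partition functions, exactly `P.Printed → B1LowerBound.LowerBoundPrinted F`.
[cite: Balaban1982Higgs2, Theorem (1.3) p.556] -/
theorem lowerBoundPrinted_iff (P : B2.Params) (F : CutoffFamily I) (fam : I → PartitionData)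
    (hvol : ∀ i, F.vol i = (fam i).volEps P.d (F.eps i)) (hZ : ∀ i, F.Z i = (fam i).Z) :
    B2Sect2Statements.LowerBoundPrinted P F.eps fam ↔ (P.Printed → B1LowerBound.LowerBoundPrinted F) := by
  unfold B2Sect2Statements.LowerBoundPrinted B1LowerBound.LowerBoundPrinted LowerBoundWith
  simp only [hvol, hZ]

/-- **Upper bound, B2 form ↔ B1 form.**  p. 556: *"Now we will prove the upper bound"* — B2's `UpperBoundPrinted P F.eps fam`
is, for data carrying the same volumes and partition functions, exactly `P.Printed → B1LowerBound.UpperBoundPrinted F`.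
[cite: Balaban1982Higgs2, Theorem (1.3) p.556] -/
theorem upperBoundPrinted_iff (P : B2.Params) (F : CutoffFamily I) (fam : I → PartitionData)
    (hvol : ∀ i, F.vol i = (fam i).volEps P.d (F.eps i)) (hZ : ∀ i, F.Z i = (fam i).Z) :
    B2Sect2Statements.UpperBoundPrinted P F.eps fam ↔ (P.Printed → B1LowerBound.UpperBoundPrinted F) := by
  unfold B2Sect2Statements.UpperBoundPrinted B1LowerBound.UpperBoundPrinted UpperBoundWith
  simp only [hvol, hZ]

/-- **Theorem (1.3) ≡ Theorem (I.1.14): the bridge.**  For a B1 cutoff family `F` and B2 partition data `fam` with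
`F.vol i = ε_i^d·#T_{ε_i}` and `F.Z i = Z^{ε_i}`, B2's `MainThmPrinted P F.eps fam` ↔ (`P.Printed` → B1's `ThmPrinted F`).
[cite: Balaban1982Higgs2, Theorem (1.3) p.556] -/
theorem mainThmPrinted_iff (P : B2.Params) (F : CutoffFamily I) (fam : I → PartitionData)
    (hvol : ∀ i, F.vol i = (fam i).volEps P.d (F.eps i)) (hZ : ∀ i, F.Z i = (fam i).Z) :
    MainThmPrinted P F.eps fam ↔ (P.Printed → ThmPrinted F) := by
  unfold MainThmPrinted ThmPrinted
  simp only [hvol, hZ]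

/-- B1 ⇒ B2 needs no parameter clause: a proof of (1.14) on the B1 carrier gives (1.3) on the B2 carrier outright.
[cite: Balaban1982Higgs2, Theorem (1.3) p.556] -/
theorem mainThmPrinted_of_thmPrinted (P : B2.Params) (F : CutoffFamily I) (fam : I → PartitionData)
    (hvol : ∀ i, F.vol i = (fam i).volEps P.d (F.eps i)) (hZ : ∀ i, F.Z i = (fam i).Z) (h : ThmPrinted F) :
    MainThmPrinted P F.eps fam :=
  (mainThmPrinted_iff P F fam hvol hZ).2 fun _ => h

/-- B2 ⇒ B1 under the printed clause *"For the dimensions d = 2, 3"* (`P.Printed`), which B2's typing carries as a guard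
and B1's carrier fixes outside the statement. [cite: Balaban1982Higgs2, Theorem (1.3) p.556] -/
theorem thmPrinted_of_mainThmPrinted (P : B2.Params) (hP : P.Printed) (F : CutoffFamily I) (fam : I → PartitionData)
    (hvol : ∀ i, F.vol i = (fam i).volEps P.d (F.eps i)) (hZ : ∀ i, F.Z i = (fam i).Z) (h : MainThmPrinted P F.eps fam) :
    ThmPrinted F :=
  (mainThmPrinted_iff P F fam hvol hZ).1 h hP

/-! ## §2 The two canonical instances of the dictionary -/

/-- Reading a B2 family AS a B1 cutoff family (spacings `eps`, volumes `volEps` = ε^d·#T_ε of part I (1.21), partition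
functions `Z`): Theorem (1.3) ↔ (clause → Theorem (I.1.14)). [cite: Balaban1982Higgs2, Theorem (1.3) p.556] -/
theorem mainThmPrinted_iff_thmPrinted_volEps (P : B2.Params) (eps : I → ℝ) (fam : I → PartitionData) :
    MainThmPrinted P eps fam ↔
      (P.Printed → ThmPrinted (⟨eps, fun i => (fam i).volEps P.d (eps i), fun i => (fam i).Z⟩ : CutoffFamily I)) :=
  mainThmPrinted_iff P ⟨eps, fun i => (fam i).volEps P.d (eps i), fun i => (fam i).Z⟩ fam (fun _ => rfl) fun _ => rfl

/-- The same instance, lower-bound half (part I's result read on the B2 carrier). [cite: Balaban1982Higgs2, Theorem (1.3) p.556] -/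
theorem lowerBoundPrinted_iff_volEps (P : B2.Params) (eps : I → ℝ) (fam : I → PartitionData) :
    B2Sect2Statements.LowerBoundPrinted P eps fam ↔
      (P.Printed → B1LowerBound.LowerBoundPrinted
        (⟨eps, fun i => (fam i).volEps P.d (eps i), fun i => (fam i).Z⟩ : CutoffFamily I)) :=
  lowerBoundPrinted_iff P ⟨eps, fun i => (fam i).volEps P.d (eps i), fun i => (fam i).Z⟩ fam (fun _ => rfl) fun _ => rfl

/-- The same instance, upper-bound half (this paper's result read on the B1 carrier). [cite: Balaban1982Higgs2, Theorem (1.3) p.556] -/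
theorem upperBoundPrinted_iff_volEps (P : B2.Params) (eps : I → ℝ) (fam : I → PartitionData) :
    B2Sect2Statements.UpperBoundPrinted P eps fam ↔
      (P.Printed → B1LowerBound.UpperBoundPrinted
        (⟨eps, fun i => (fam i).volEps P.d (eps i), fun i => (fam i).Z⟩ : CutoffFamily I)) :=
  upperBoundPrinted_iff P ⟨eps, fun i => (fam i).volEps P.d (eps i), fun i => (fam i).Z⟩ fam (fun _ => rfl) fun _ => rfl

/-- Reading a B1 cutoff family whose volumes ARE ε^d times site counts (`n i` = #T_{ε_i}, part I (1.21) *"|Λ| = Σ_{x∈Λ} η^d =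
η^d (a number of points in Λ)"*) AS the B2 family `i ↦ ⟨n i, F.Z i⟩`: Theorem (I.1.14) on `F` ↔ Theorem (1.3) on it, under
the clause. [cite: Balaban1982Higgs2, Theorem (1.3) p.556] -/
theorem thmPrinted_iff_mainThmPrinted_of_count (P : B2.Params) (hP : P.Printed) (F : CutoffFamily I) (n : I → ℕ)
    (hvol : ∀ i, F.vol i = F.eps i ^ P.d * (n i : ℝ)) :
    ThmPrinted F ↔ MainThmPrinted P F.eps (fun i => (⟨n i, F.Z i⟩ : PartitionData)) := by
  rw [mainThmPrinted_iff P F (fun i => (⟨n i, F.Z i⟩ : PartitionData)) (fun i => hvol i) fun _ => rfl]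
  exact ⟨fun h _ => h, fun h => h hP⟩

/-- The site-count instance, lower-bound half. [cite: Balaban1982Higgs2, Theorem (1.3) p.556] -/
theorem lowerBoundPrinted_iff_of_count (P : B2.Params) (hP : P.Printed) (F : CutoffFamily I) (n : I → ℕ)
    (hvol : ∀ i, F.vol i = F.eps i ^ P.d * (n i : ℝ)) :
    B1LowerBound.LowerBoundPrinted F ↔
      B2Sect2Statements.LowerBoundPrinted P F.eps (fun i => (⟨n i, F.Z i⟩ : PartitionData)) := by
  rw [lowerBoundPrinted_iff P F (fun i => (⟨n i, F.Z i⟩ : PartitionData)) (fun i => hvol i) fun _ => rfl]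
  exact ⟨fun h _ => h, fun h => h hP⟩

/-- The site-count instance, upper-bound half. [cite: Balaban1982Higgs2, Theorem (1.3) p.556] -/
theorem upperBoundPrinted_iff_of_count (P : B2.Params) (hP : P.Printed) (F : CutoffFamily I) (n : I → ℕ)
    (hvol : ∀ i, F.vol i = F.eps i ^ P.d * (n i : ℝ)) :
    B1LowerBound.UpperBoundPrinted F ↔
      B2Sect2Statements.UpperBoundPrinted P F.eps (fun i => (⟨n i, F.Z i⟩ : PartitionData)) := by
  rw [upperBoundPrinted_iff P F (fun i => (⟨n i, F.Z i⟩ : PartitionData)) (fun i => hvol i) fun _ => rfl]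
  exact ⟨fun h _ => h, fun h => h hP⟩

/-! ## §3 Assembly across the two papers -/

/-- **(1.3) assembled from its two printed halves living in the two papers' carriers**: part I's lower bound on the B1
carrier (`B1LowerBound.LowerBoundPrinted F`) and this paper's upper bound on the B2 carrier (`UpperBoundPrinted P F.eps fam`)
give the Theorem on the B2 carrier — *"In the first part [1], we have proved the first inequality above, the lower bound. Now
we will prove the upper bound."* [cite: Balaban1982Higgs2, Theorem (1.3) p.556] -/
theorem mainThmPrinted_of_B1lower_B2upper (P : B2.Params) (F : CutoffFamily I) (fam : I → PartitionData)
    (hvol : ∀ i, F.vol i = (fam i).volEps P.d (F.eps i)) (hZ : ∀ i, F.Z i = (fam i).Z)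
    (hlow : B1LowerBound.LowerBoundPrinted F) (hup : B2Sect2Statements.UpperBoundPrinted P F.eps fam) :
    MainThmPrinted P F.eps fam :=
  B2Sect2Statements.mainThmPrinted_of_bounds P F.eps fam ((lowerBoundPrinted_iff P F fam hvol hZ).2 fun _ => hlow) hup

/-- … and the same assembly read back on the B1 carrier: Theorem (I.1.14) for `F` from part I's lower bound (B1 form) and
part II's upper bound (B2 form), under the clause. [cite: Balaban1982Higgs2, Theorem (1.3) p.556] -/
theorem thmPrinted_of_B1lower_B2upper (P : B2.Params) (hP : P.Printed) (F : CutoffFamily I) (fam : I → PartitionData)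
    (hvol : ∀ i, F.vol i = (fam i).volEps P.d (F.eps i)) (hZ : ∀ i, F.Z i = (fam i).Z)
    (hlow : B1LowerBound.LowerBoundPrinted F) (hup : B2Sect2Statements.UpperBoundPrinted P F.eps fam) :
    ThmPrinted F :=
  (B1LowerBound.thmPrinted_iff F).2 ⟨hlow, (upperBoundPrinted_iff P F fam hvol hZ).1 hup hP⟩

end Literature.MathematicalPhysics.QuantumFieldTheory.Balaban1983to89.B2Thm13Bridge
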